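import Literature.MathematicalPhysics.QuantumFieldTheory.Balaban1983to89.B9RWSums344Input

/-!
# `Balaban1983to89.B9RWSums346Two` — [B9] the two-sided L² line ‖h∇_UG(U)∇\*_UJ‖ of (3.46) for the random walk sum (3.107) G(U)
# PROVED inside the leaf of Theorem 3.10 at the all-blocks pin — the LAST displayed member: the leaf of Theorem 3.3 for the sum
# now follows from operator-level hypothesis schemas of printed shape alone

T. Bałaban, *Propagators for lattice gauge theories in a background field*, Commun. Math. Phys. **99** (1985) 389–434
[`Balaban1985BackgroundPropagators`, "B9"]; [4] = T. Bałaban, *Propagators and renormalization transformations for lattice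
gauge theories. II*, Commun. Math. Phys. **96** (1984) 223–250 [`Balaban1984PropagatorsII`].

statement-level skeleton of published theorems with citation tags; proofs where landed; nothing here is a claim about the
Yang–Mills mass gap

THE PRINTED LOCI (verbatim).  (3.46), p. 398: *"Finally, we have the inequalities in L²-norms ‖hG′(U)λ‖, ‖h∇_UG′(U)λ‖,
‖hG′(U)∇\*_Uλ‖, ‖hΔ_UG′(U)λ‖, … ≦ B₀[(L^jη)², L^jη, L^jη, 1, 1, 1]|h|e^{−δ₀d(y,y′)}‖λ‖ for supp h ⊂ Δ(y), y ∈ Λ_j, supp λ ⊂ Δ(y′)"*;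
(3.106) p. 414: *"G = G₀(I − R)⁻¹"*; p. 413: *"An operator R_α(X) … satisfies a bound of the type (3.89), possibly with an
additional power of L^jη"*; Theorem 3.10 p. 416: *"… the corresponding inequalities for norms on the left-hand sides of
(3.42)–(3.47) … This implies Theorem 3.3."*

THE POINT.  After `B9RWSums344Input` the leaf of Theorem 3.10 at the all-blocks pin (`thm310Printed_allPin_inputHolder`) displays ONE
member of Theorem 3.3 for the kernel family read from the sum: the two-sided L² line n = 4, ‖h∇_UG∇\*_UJ‖ ≦ B₀|h|e^{−δ₀d}‖J‖ — the
Schur route of `B9RWSums346Schur` cannot reach it (∇_UG∇\*_U has no sup majorant; its printed sup bound (3.44) is an input-Hölder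
bound).  THIS FILE proves it in the block-L² calculus (r1's `B9SectDL2Decay.BlockBd` = n06-b's `B11SectG.HasMaj` between the
unweighted block-L² norms `l2w`, `blockBd_iff_hasMaj`) by the same one-composition route as (3.44): ∇_UG∇\*_U = ∇_UG₀∇\*_U +
(∇_UG)(R∇\*_U) ((3.106)); the head terms' L² legs (Cor. 3.6's (3.46) two-sided line for the h_□G_□h_□, POSITED), the L² block bound
of ∇_UG of the sibling (`B9RWSums346Schur.blockBd_entry1`: Schur from the pin's sup majorants and the transpose letter), and the
factors' L² bounds R_a∇\*_U with the power (L^jη)⁻¹ (POSITED, p. 413), composed once with p. 398's transfer and [4] (2.61):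

* §1 `tail_comp_l2` (the block-L² twin of `B9RWSums344Input.tail_comp`); §2 schemas `L2TwoLegs310`, `FactorsL2_310`, `twoConst`,
  the one-member theorem `l2line4_of_local310`, and ★ `thm310Printed_allPin_complete` — **the leaf `B9.Thm310Printed` at
  `W310OfOps … (ConvAll3107 …)` WITH NO DISPLAYED RESIDUAL**: every member of Theorem 3.3 for `K i` ((3.42)–(3.47)) is proved inside
  from the operator-level hypothesis schemas of the lineage (Cor. 3.6 for the G_□ in the printed norms, the factor bounds of type
  (3.89), the structure (3.105), readings, letters, member facts).

HONEST SCOPE.  Nothing of print is asserted: the L² legs and the factors' L² bounds are hypotheses of printed shape (Cor. 3.6's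
(3.46) for the G_□ with the product rules through h_□; p. 413 for R_α(X)∇\*_U); «no displayed residual» means «no hypothesis about
the SUM»: all inputs concern the local operators, the elementary factors, the readings and the letters — exactly print's
*"From (3.108) it follows that the expansion (3.107) is convergent in all norms"*, kernel-checked as bookkeeping over those
inputs.  NOT a node discharge, NOT summit progress; one finite lattice paper; nothing continuum, nothing about the mass gap.  Cell
`pub-ymgap` (HUMAN RULING D-0062), Track A node N06 [B9], seat `pub-ymgap-dag-n06-k` (rows 18–19, successor gen), 2026-08-27.
-/

namespace Literature.MathematicalPhysics.QuantumFieldTheory.Balaban1983to89.B9RWSums346Two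

open Literature.MathematicalPhysics.QuantumFieldTheory.Balaban1983to89
open Finset B6RandomWalk B6RandomWalkHom B9Thm37Sum B9Thm34Ext B9Thm37Glue B9Thm37Whole B9Cor38Whole B9Thm310Whole
open B9RWSums343to347Whole B9RWSums346Schur B9Thm37GlueCor36 B9RWSums343Holder B9RWSums346Lap B9RWSums344Input
open B11SectG B9Thm37AllNorms B9SectDL2Decay B9Ineq347 B9Ineq347AllEntries

noncomputable section

/-! ## §1 The tail composition in the block-L² norms -/

section Tail

variable {g : B9.Geometry} [Fintype g.Site] {R : ℝ} {H : Prop} {X Y Z : Type} [Fintype X] [Fintype Y] [Fintype Z]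

/-- **THE TAIL COMPOSITION IN BLOCK-L² NORMS** (the second summand of ∇_UG∇\*_U = ∇_UG₀∇\*_U + (∇_UG)(R∇\*_U) for the L² line):
S with the L² block bound C·L^jη·e^{−ρd} (the sibling's `blockBd_entry1` for ∇_UG, ρ = (1 − α)δ) after P with the L² block bound
θ·(L^jη)⁻¹·e^{−δ₁d} (the factors R∇\*_U summed) has the L² block bound CθL₀c₁(α₁)·e^{−ρ′d(y,y′)} for ρ = αδ + ρ′ with 0 ≦ ρ′ ≦
(1 − α₁)δ₁ — `B11SectG.hasMaj_comp` between the `l2w` norms (κ = 1), the transfer L^jη(L^{j″}η)⁻¹e^{−αδd(y,y″)} ≦ L₀ ((2.60)) and [4]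
(2.61) at (δ₁, α₁) (`B9RWSums343Holder.conv_exp_le_of_261`). [cite: Balaban1985BackgroundPropagators, (3.46) p.398 + (3.106) p.414 + p.413 + p.398; Balaban1984PropagatorsII, (2.52)–(2.55) p.232 + Lemma 2.1 (2.60)–(2.61) p.234] -/
theorem tail_comp_l2 (blk : X → g.Site) (blkY : Y → g.Site) (blkZ : Z → g.Site) {S : (X → ℝ) →ₗ[ℝ] (Z → ℝ)}
    {P : (Y → ℝ) →ₗ[ℝ] (X → ℝ)} {d d₁ : ℕ} {δ α L₀ δ₁ α₁ C θ ρ ρ' : ℝ} (hF : Facts347 g R H d δ α L₀)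
    (h261 : Ineq261 d₁ (toB6 g R H) δ₁ α₁) (htri : Triangle254 (toB6 g R H))
    (hsymm : ∀ y y' : g.Site, g.dist y y' = g.dist y' y) (hdnn : ∀ y y' : g.Site, 0 ≤ g.dist y y')
    (hlen : ∀ y : g.Site, 0 < g.len y) (hC : 0 ≤ C) (hθ : 0 ≤ θ) (hρ : ρ = α * δ + ρ') (hρ' : 0 ≤ ρ')
    (hrate : ρ' ≤ (1 - α₁) * δ₁)
    (hS : BlockBd (g := toB6 g R H) blk blkZ S (fun (a b : g.Site) => C * g.len a * Real.exp (-(ρ * g.dist a b))))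
    (hP : BlockBd (g := toB6 g R H) blkY blk P (fun (y y' : g.Site) => θ * (g.len y)⁻¹ * Real.exp (-(δ₁ * g.dist y y')))) :
    BlockBd (g := toB6 g R H) blkY blkZ (S ∘ₗ P)
      (fun (a b : g.Site) => C * θ * L₀ * B6.c1 d₁ δ₁ α₁ * Real.exp (-(ρ' * g.dist a b))) := by
  have hlen0 : ∀ y : g.Site, 0 ≤ g.len y := fun y => (hlen y).le
  have hL₀ : 0 ≤ L₀ := le_trans (le_trans zero_le_one hF.one_le_L) hF.L_le
  have hK : ∀ a b : g.Site, 0 ≤ C * g.len a * Real.exp (-(ρ * g.dist a b)) := fun a b =>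
    mul_nonneg (mul_nonneg hC (hlen0 a)) (Real.exp_nonneg _)
  have hS' := (blockBd_iff_hasMaj (g := toB6 g R H) blk blkZ S _).mp hS
  have hP' := (blockBd_iff_hasMaj (g := toB6 g R H) blkY blk P _).mp hP
  have hcomp := hasMaj_comp hS' hP' hK
  rw [blockBd_iff_hasMaj]
  refine hcomp.mono fun a b => ?_
  rw [l2w_κ]
  -- the transfer: L^jη (L^{j″}η)⁻¹ e^{−ρd(y,y″)} ≤ L₀ e^{−ρ′d(y,y″)}
  have htransfer : ∀ z : g.Site, g.len a * (g.len z)⁻¹ * Real.exp (-(ρ * g.dist a z)) ≤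
      L₀ * Real.exp (-(ρ' * g.dist a z)) := by
    intro z
    have hst : Real.exp (-(α * δ * g.dist a z)) * g.len z ^ (-1 : ℝ) ≤ g.L ^ |(-1 : ℝ)| * g.len a ^ (-1 : ℝ) :=
      scaleTransfer_len_rpow hF (-1) (by norm_num) a z
    rw [Real.rpow_neg_one, Real.rpow_neg_one, abs_neg, abs_one, Real.rpow_one] at hst
    have hsplit : Real.exp (-(ρ * g.dist a z)) = Real.exp (-(α * δ * g.dist a z)) * Real.exp (-(ρ' * g.dist a z)) := by
      rw [← Real.exp_add, hρ]; congr 1; ring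
    have hkey : g.len a * (g.len z)⁻¹ * Real.exp (-(α * δ * g.dist a z)) ≤ L₀ := by
      have h1 : g.len a * (Real.exp (-(α * δ * g.dist a z)) * (g.len z)⁻¹) ≤ g.len a * (g.L * (g.len a)⁻¹) :=
        mul_le_mul_of_nonneg_left hst (hlen0 a)
      have h2 : g.len a * (g.L * (g.len a)⁻¹) = g.L := by
        rw [mul_comm g.L, ← mul_assoc, mul_inv_cancel₀ (hlen a).ne', one_mul]
      calc g.len a * (g.len z)⁻¹ * Real.exp (-(α * δ * g.dist a z))
          = g.len a * (Real.exp (-(α * δ * g.dist a z)) * (g.len z)⁻¹) := by ring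
        _ ≤ g.L := by rw [← h2]; exact h1
        _ ≤ L₀ := hF.L_le
    rw [hsplit]
    calc g.len a * (g.len z)⁻¹ * (Real.exp (-(α * δ * g.dist a z)) * Real.exp (-(ρ' * g.dist a z)))
        = (g.len a * (g.len z)⁻¹ * Real.exp (-(α * δ * g.dist a z))) * Real.exp (-(ρ' * g.dist a z)) := by ring
      _ ≤ L₀ * Real.exp (-(ρ' * g.dist a z)) := mul_le_mul_of_nonneg_right hkey (Real.exp_nonneg _)
  -- the convolution at (δ₁, α₁)
  have hconv : ∑ z : g.Site, Real.exp (-(ρ' * g.dist a z)) * Real.exp (-(δ₁ * g.dist z b)) ≤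
      B6.c1 d₁ δ₁ α₁ * Real.exp (-(ρ' * g.dist a b)) := by
    have h := conv_exp_le_of_261 (R := R) (H := H) d₁ δ₁ α₁ ρ' hρ' hrate htri hdnn h261 b a
    have hrw : ∀ z : g.Site, Real.exp (-(ρ' * g.dist a z)) * Real.exp (-(δ₁ * g.dist z b)) =
        Real.exp (-(δ₁ * g.dist b z)) * Real.exp (-(ρ' * g.dist z a)) := by
      intro z; rw [hsymm a z, hsymm z b, mul_comm]
    rw [Finset.sum_congr rfl fun z _ => hrw z, hsymm a b]
    exact h
  calc (∑ z : g.Site, C * g.len a * Real.exp (-(ρ * (toB6 g R H).dist a z)) *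
          (1 * (θ * (g.len z)⁻¹ * Real.exp (-(δ₁ * (toB6 g R H).dist z b)))))
      = C * θ * ∑ z : g.Site, (g.len a * (g.len z)⁻¹ * Real.exp (-(ρ * g.dist a z))) * Real.exp (-(δ₁ * g.dist z b)) := by
        simp only [toB6_dist]
        rw [Finset.mul_sum]
        exact Finset.sum_congr rfl fun z _ => by ring
    _ ≤ C * θ * ∑ z : g.Site, (L₀ * Real.exp (-(ρ' * g.dist a z))) * Real.exp (-(δ₁ * g.dist z b)) := by
        refine mul_le_mul_of_nonneg_left (Finset.sum_le_sum fun z _ => ?_) (mul_nonneg hC hθ)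
        exact mul_le_mul_of_nonneg_right (htransfer z) (Real.exp_nonneg _)
    _ = C * θ * L₀ * ∑ z : g.Site, Real.exp (-(ρ' * g.dist a z)) * Real.exp (-(δ₁ * g.dist z b)) := by
        rw [Finset.mul_sum, Finset.mul_sum]
        exact Finset.sum_congr rfl fun z _ => by ring
    _ ≤ C * θ * L₀ * (B6.c1 d₁ δ₁ α₁ * Real.exp (-(ρ' * g.dist a b))) :=
        mul_le_mul_of_nonneg_left hconv (mul_nonneg (mul_nonneg hC hθ) hL₀)
    _ = C * θ * L₀ * B6.c1 d₁ δ₁ α₁ * Real.exp (-(ρ' * g.dist a b)) := by ring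

omit [Fintype X] [Fintype Y] [Fintype Z] in
/-- Algebra of (3.106) read through ∇_U on the left and ∇\*_U on the right. [folklore] -/
private theorem twoSided_split₂ {Y' : Type} {E : (X → ℝ) →ₗ[ℝ] (Z → ℝ)} {Dst : (Y' → ℝ) →ₗ[ℝ] (X → ℝ)}
    {G G0 W : Module.End ℝ (X → ℝ)} (h : G = G0 + G * W) :
    E ∘ₗ (G ∘ₗ Dst) = E ∘ₗ (G0 ∘ₗ Dst) + (E ∘ₗ G) ∘ₗ (W ∘ₗ Dst) := by
  conv_lhs => rw [h]
  apply LinearMap.ext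
  intro μ
  simp only [LinearMap.comp_apply, LinearMap.add_apply, Module.End.mul_apply, map_add]

/-- Localized L² block bounds sum with the overlap count (via `blockBd_iff_hasMaj` and `B9Thm37AllNorms.hasMaj_localSum`).
[cite: Balaban1985BackgroundPropagators, (3.87) p.409 + (3.46) p.398] -/
theorem blockBd_localSum {ι : Type} [Fintype ι] (blk₁ : X → g.Site) (blk₂ : Z → g.Site) (T : ι → (X → ℝ) →ₗ[ℝ] (Z → ℝ))
    (χ : ι → g.Site → ℝ) (κ : g.Site → g.Site → ℝ) (N : ℝ) (hκ : ∀ a c, 0 ≤ κ a c)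
    (hT : ∀ i, BlockBd (g := toB6 g R H) blk₁ blk₂ (T i) (fun a c => χ i a * κ a c)) (hN : ∀ a, ∑ i, χ i a ≤ N) :
    BlockBd (g := toB6 g R H) blk₁ blk₂ (∑ i, T i) (fun a c => N * κ a c) := by
  rw [blockBd_iff_hasMaj]
  exact hasMaj_localSum (G := toB6 g R H) T χ κ N hκ (fun i => (blockBd_iff_hasMaj (g := toB6 g R H) blk₁ blk₂ (T i) _).mp (hT i)) hN

/-- L² block bounds add. [folklore] -/
private theorem blockBd_add (blk₁ : X → g.Site) (blk₂ : Z → g.Site) {T₁ T₂ : (X → ℝ) →ₗ[ℝ] (Z → ℝ)}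
    {K₁ K₂ : g.Site → g.Site → ℝ} (h₁ : BlockBd (g := toB6 g R H) blk₁ blk₂ T₁ K₁)
    (h₂ : BlockBd (g := toB6 g R H) blk₁ blk₂ T₂ K₂) :
    BlockBd (g := toB6 g R H) blk₁ blk₂ (T₁ + T₂) (fun a b => K₁ a b + K₂ a b) := by
  rw [blockBd_iff_hasMaj] at h₁ h₂ ⊢
  exact h₁.add h₂

end Tail

/-! ## §2 The sum G(U) of (3.107): the two-sided L² legs, the factors' L² bounds, the line at one member, the complete leaf -/

section GSide

variable {g : B9.Geometry} [Fintype g.Site] [DecidableEq g.Site] {R : ℝ} {H : Prop} {B : B9.Backgrounds}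
variable {X Y ι A : Type}

/-- **COROLLARY 3.6's TWO-SIDED L² LINE OF (3.46) FOR THE HEAD TERMS h_□G_□(U)h_□ OF (3.107), LOCALIZED**: ∇_U(h_□G_□h_□)∇\*_U has the
L² block bound 1_{S₂(□)}(y)·B₂·e^{−δ₀d(y,y′)} (‖1_{Δ(y)}∇_Uh_□G_□h_□∇\*_Uμ‖₂ ≦ … ‖μ‖₂, supp μ ⊂ Δ(y′)).  POSITED AS A WHOLE (incl. the
product rules through h_□); a HYPOTHESIS SCHEMA, Corollary 3.6 is not asserted.
[cite: Balaban1985BackgroundPropagators, Cor. 3.6 p.408 + (3.46) p.398 + (3.100) p.413] -/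
structure L2TwoLegs310 [Fintype Y] (𝔬 : Ops310 g B X Y ι A) (R : ℝ) (H : Prop) (S2 : ι → Finset g.Site) (B2 δ₀ : ℝ)
    (U : B.Cfg) : Prop where
  l4 : ∀ i, BlockBd (g := toB6 g R H) 𝔬.blkY 𝔬.blkY (𝔬.D U ∘ₗ ((mulOp (𝔬.h i) * 𝔬.Gsq U i * mulOp (𝔬.h i)) ∘ₗ 𝔬.Dstar U))
    (fun (a b : g.Site) => (if a ∈ S2 i then (1 : ℝ) else 0) * (B2 * Real.exp (-(δ₀ * g.dist a b))))

/-- **THE FACTORS R_a(U)∇\*_U IN THE BLOCK-L² NORMS** (p. 413, *"bound of the type (3.89), possibly with an additional power of L^jη"*):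
‖1_{Δ(y)}R_a∇\*_Uμ‖₂ ≦ 1_{X∩𝔅}(y)·θ₂M⁻¹·(L^jη)⁻¹·e^{−δ₀d(y,y′)}‖μ‖₂, supp μ ⊂ Δ(y′).  POSITED; a HYPOTHESIS SCHEMA.
[cite: Balaban1985BackgroundPropagators, p.413 + (3.105) p.414 + (3.46) p.398] -/
structure FactorsL2_310 [Fintype X] [Fintype Y] (𝔬 : Ops310 g B X Y ι A) (R : ℝ) (H : Prop) (θ2 δ₀ : ℝ) (U : B.Cfg) :
    Prop where
  facD : ∀ a : A, BlockBd (g := toB6 g R H) 𝔬.blkY 𝔬.blk (𝔬.Rf U a ∘ₗ 𝔬.Dstar U)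
    (fun (y y' : g.Site) => (if y ∈ 𝔬.SF a then (1 : ℝ) else 0) * (θ2 * g.M⁻¹ * (g.len y)⁻¹ * Real.exp (-(δ₀ * g.dist y y'))))

/-- **The constant of the two-sided L² line of the sum**: N₂·B₂ + C·L₀·(N_F·θ₂)·L₀·c₁(α₁) (head legs summed; the sibling's L² bound
C·L₀·L^jη of ∇_UG, the factors summed, the transfer, one convolution). [cite: Balaban1985BackgroundPropagators, (3.46) p.398 + Thm 3.10 p.416] -/
def twoConst (d₁ : ℕ) (δ₁ α₁ N2 B2 NF θ2 C L₀ : ℝ) : ℝ :=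
  N2 * B2 + C * L₀ * (NF * θ2) * L₀ * B6.c1 d₁ δ₁ α₁

/-- **THE TWO-SIDED L² LINE OF (3.46) FOR THE SUM G(U) OF (3.107) AT ONE MEMBER AND ONE CONFIGURATION U** — the L² block bound of
∇_UG∇\*_U: from (3.106) read as ∇_UG∇\*_U = ∇_UG₀∇\*_U + (∇_UG)(R∇\*_U), the L² legs summed with N₂, the sibling's L² block bound of
∇_UG (`B9RWSums346Schur.blockBd_entry1` from the pin's sup majorants of ∇_UG, G∇\*_U and the transpose letter), the factors' L² bounds
summed with N_F, and `tail_comp_l2` (transfer at the pin's (δ, α), convolution at (δ₁, α₁)): ‖1_{Δ(y)}∇_UG∇\*_Uμ‖₂ ≦ `twoConst …`·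
e^{−(1−2α)δd(y,y′)}‖μ‖₂ for supp μ ⊂ Δ(y′), provided 2αδ ≦ δ and (1 − 2α)δ ≦ (1 − α₁)δ₁.
[cite: Balaban1985BackgroundPropagators, Thm 3.10 (3.105)–(3.108) pp.414–416 + (3.46) p.398 + p.413 + p.391; Balaban1984PropagatorsII, (2.52)–(2.55) p.232 + Lemma 2.1 p.234] -/
theorem l2line4_of_local310 [Fintype X] [DecidableEq X] [Fintype Y] [DecidableEq Y] [Fintype ι] [Fintype A]
    (𝔬 : Ops310 g B X Y ι A) (R : ℝ) (H : Prop) (d d₁ : ℕ) (δ α L₀ δ₁ α₁ ρ N N' NF Cℓ N2 B2 θ2 C : ℝ) (κ : Sizes310)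
    (S2 : ι → Finset g.Site) (U : B.Cfg)
    (hNF : 0 ≤ NF) (hN2 : 0 ≤ N2) (hB2 : 0 ≤ B2) (hθ2 : 0 ≤ θ2) (hM : 1 ≤ g.M) (hC : 0 ≤ C)
    (hα2 : 2 * α * δ ≤ δ) (hα₁δ₁ : 0 ≤ α₁ * δ₁) (hrate : (1 - 2 * α) * δ ≤ (1 - α₁) * δ₁)
    (hs : StaticOK310 𝔬 ρ N N' NF Cℓ κ) (hcnt2 : ∀ a : g.Site, (∑ i, if a ∈ S2 i then (1 : ℝ) else 0) ≤ N2)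
    (h261 : Ineq261 d₁ (toB6 g R H) δ₁ α₁) (hF : Facts347 g R H d δ α L₀) (hi : Identities310 𝔬 R H U)
    (hL : L2TwoLegs310 𝔬 R H S2 B2 δ₁ U) (hFL : FactorsL2_310 𝔬 R H θ2 δ₁ U)
    (h1 : HasMajorantHom (g := toB6 g R H) 𝔬.blk 𝔬.blkY (𝔬.D U ∘ₗ 𝔬.G U)
      (fun (a b : g.Site) => C * g.len a * Real.exp (-(δ * g.dist a b))))
    (h2 : HasMajorantHom (g := toB6 g R H) 𝔬.blkY 𝔬.blk (𝔬.G U ∘ₗ 𝔬.Dstar U)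
      (fun (a b : g.Site) => C * g.len a * Real.exp (-(δ * g.dist a b))))
    (htr : IsTransposePair (𝔬.D U ∘ₗ 𝔬.G U) (𝔬.G U ∘ₗ 𝔬.Dstar U)) :
    BlockBd (g := toB6 g R H) 𝔬.blkY 𝔬.blkY (𝔬.D U ∘ₗ (𝔬.G U ∘ₗ 𝔬.Dstar U))
      (fun (a b : g.Site) => twoConst d₁ δ₁ α₁ N2 B2 NF θ2 C L₀ * Real.exp (-((1 - 2 * α) * δ * g.dist a b))) := by
  have hMpos : 0 < g.M := lt_of_lt_of_le one_pos hM
  have hMinv : g.M⁻¹ ≤ 1 := inv_le_one_of_one_le₀ hM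
  have hMinv0 : 0 ≤ g.M⁻¹ := inv_nonneg.mpr hMpos.le
  have hlen0 : ∀ y : g.Site, 0 ≤ g.len y := fun y => (hs.lenpos y).le
  have htri : Triangle254 (toB6 g R H) := fun a b c => hs.tri a b c
  have hc1 : 0 ≤ B6.c1 d₁ δ₁ α₁ := c1_nonneg d₁ δ₁ α₁
  have hL₀ : 0 ≤ L₀ := le_trans (le_trans zero_le_one hF.one_le_L) hF.L_le
  have hρ'0 : 0 ≤ (1 - 2 * α) * δ := by nlinarith [hα2]
  have hexp : ∀ a b : g.Site, Real.exp (-(δ₁ * g.dist a b)) ≤ Real.exp (-((1 - 2 * α) * δ * g.dist a b)) := fun a b =>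
    Real.exp_le_exp.mpr (neg_le_neg (mul_le_mul_of_nonneg_right (by nlinarith [hrate, hα₁δ₁]) (hs.dnn a b)))
  -- (3.106)
  have hfix : 𝔬.G U = (∑ i, mulOp (𝔬.h i) * 𝔬.Gsq U i * mulOp (𝔬.h i)) + 𝔬.G U * ∑ a, 𝔬.Rf U a :=
    fixedPoint_of_388 hi.inv hi.eq3105
  have hsumE : 𝔬.D U ∘ₗ ((∑ i, mulOp (𝔬.h i) * 𝔬.Gsq U i * mulOp (𝔬.h i)) ∘ₗ 𝔬.Dstar U) =
      ∑ i, 𝔬.D U ∘ₗ ((mulOp (𝔬.h i) * 𝔬.Gsq U i * mulOp (𝔬.h i)) ∘ₗ 𝔬.Dstar U) := by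
    apply LinearMap.ext
    intro μ
    simp only [LinearMap.comp_apply, LinearMap.sum_apply, map_sum]
  -- the factors R_a∇* summed with N_F
  have hsumF : (∑ a, 𝔬.Rf U a) ∘ₗ 𝔬.Dstar U = ∑ a, 𝔬.Rf U a ∘ₗ 𝔬.Dstar U := by
    apply LinearMap.ext
    intro μ
    simp only [LinearMap.comp_apply, LinearMap.sum_apply]
  have hP : BlockBd (g := toB6 g R H) 𝔬.blkY 𝔬.blk ((∑ a, 𝔬.Rf U a) ∘ₗ 𝔬.Dstar U)
      (fun (y y' : g.Site) => NF * (θ2 * g.M⁻¹) * (g.len y)⁻¹ * Real.exp (-(δ₁ * g.dist y y'))) := by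
    rw [hsumF]
    have h := blockBd_localSum (R := R) (H := H) 𝔬.blkY 𝔬.blk (fun a => 𝔬.Rf U a ∘ₗ 𝔬.Dstar U)
      (fun a (y : g.Site) => if y ∈ 𝔬.SF a then (1 : ℝ) else 0)
      (fun (y y' : g.Site) => θ2 * g.M⁻¹ * (g.len y)⁻¹ * Real.exp (-(δ₁ * g.dist y y'))) NF
      (fun y y' => mul_nonneg (mul_nonneg (mul_nonneg hθ2 hMinv0) (inv_nonneg.mpr (hlen0 y))) (Real.exp_nonneg _))
      hFL.facD hs.cntF
    exact h.mono fun y y' => le_of_eq (by ring)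
  -- the L² bound of ∇_UG by the Schur test of the sibling
  have hS := blockBd_entry1 hF hC hs.symm hs.lenpos 𝔬.blk 𝔬.blkY h1 h2 htr
  have hρ : (1 - α) * δ = α * δ + (1 - 2 * α) * δ := by ring
  have htail := tail_comp_l2 (R := R) (H := H) 𝔬.blk 𝔬.blkY 𝔬.blkY hF h261 htri hs.symm hs.dnn hs.lenpos (mul_nonneg hC hL₀)
    (mul_nonneg hNF (mul_nonneg hθ2 hMinv0)) hρ hρ'0 hrate hS hP
  have hhead := blockBd_localSum (R := R) (H := H) 𝔬.blkY 𝔬.blkY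
    (fun i => 𝔬.D U ∘ₗ ((mulOp (𝔬.h i) * 𝔬.Gsq U i * mulOp (𝔬.h i)) ∘ₗ 𝔬.Dstar U))
    (fun i (a : g.Site) => if a ∈ S2 i then (1 : ℝ) else 0) (fun (a b : g.Site) => B2 * Real.exp (-(δ₁ * g.dist a b))) N2
    (fun a b => mul_nonneg hB2 (Real.exp_nonneg _)) hL.l4 hcnt2
  rw [twoSided_split₂ hfix, hsumE]
  refine (blockBd_add (R := R) (H := H) 𝔬.blkY 𝔬.blkY hhead htail).mono fun a b => ?_
  have hK0 : 0 ≤ N2 * B2 := mul_nonneg hN2 hB2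
  have ht : C * L₀ * (NF * (θ2 * g.M⁻¹)) * L₀ * B6.c1 d₁ δ₁ α₁ ≤ C * L₀ * (NF * θ2) * L₀ * B6.c1 d₁ δ₁ α₁ := by
    have h3 : θ2 * g.M⁻¹ ≤ θ2 := by
      calc θ2 * g.M⁻¹ ≤ θ2 * 1 := mul_le_mul_of_nonneg_left hMinv hθ2
        _ = θ2 := mul_one _
    have h4 : C * L₀ * (NF * (θ2 * g.M⁻¹)) ≤ C * L₀ * (NF * θ2) :=
      mul_le_mul_of_nonneg_left (mul_le_mul_of_nonneg_left h3 hNF) (mul_nonneg hC hL₀)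
    exact mul_le_mul_of_nonneg_right (mul_le_mul_of_nonneg_right h4 hL₀) hc1
  calc N2 * (B2 * Real.exp (-(δ₁ * g.dist a b))) +
        C * L₀ * (NF * (θ2 * g.M⁻¹)) * L₀ * B6.c1 d₁ δ₁ α₁ * Real.exp (-((1 - 2 * α) * δ * g.dist a b))
      = N2 * B2 * Real.exp (-(δ₁ * g.dist a b)) +
        C * L₀ * (NF * (θ2 * g.M⁻¹)) * L₀ * B6.c1 d₁ δ₁ α₁ * Real.exp (-((1 - 2 * α) * δ * g.dist a b)) := by ring
    _ ≤ N2 * B2 * Real.exp (-((1 - 2 * α) * δ * g.dist a b)) +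
        C * L₀ * (NF * θ2) * L₀ * B6.c1 d₁ δ₁ α₁ * Real.exp (-((1 - 2 * α) * δ * g.dist a b)) :=
        add_le_add (mul_le_mul_of_nonneg_left (hexp a b) hK0) (mul_le_mul_of_nonneg_right ht (Real.exp_nonneg _))
    _ = twoConst d₁ δ₁ α₁ N2 B2 NF θ2 C L₀ * Real.exp (-((1 - 2 * α) * δ * g.dist a b)) := by
        unfold twoConst; ring

omit [Fintype g.Site] [DecidableEq g.Site] in
/-- Arithmetic of «for M sufficiently large»: M ≧ 2N_Fθ₀c₁ gives N_F·θ₀M⁻¹·c₁ ≦ ½. [folklore] -/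
private theorem small_of_threshold₄ {NF θ₀ c M : ℝ} (hM : 0 < M) (hbig : 2 * NF * θ₀ * c ≤ M) :
    NF * (θ₀ * M⁻¹) * c ≤ 1 / 2 := by
  have h1 : NF * (θ₀ * M⁻¹) * c = (NF * θ₀ * c) / M := by
    rw [div_eq_mul_inv]
    ring
  rw [h1, div_le_iff₀ hM]
  linarith

/-- `B9.pref6 t 4 = 1` (the prefactor of the line ‖h∇_UG∇\*_UJ‖). [cite: Balaban1985BackgroundPropagators, (3.46) p.398] -/
theorem pref6_four (t : ℝ) : B9.pref6 t 4 = 1 := by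
  simp [B9.pref6]

end GSide

/-! ### The complete leaf: no displayed residual -/

section AllPinsG

variable {I : Type} {c35 : ℝ} {geo : I → B9.Geometry} {bg : I → B9.Backgrounds}
variable [∀ i, Fintype (geo i).Site] [∀ i, DecidableEq (geo i).Site]

/-- ★ **THEOREM 3.10 AT THE ALL-BLOCKS PIN WITH NO DISPLAYED RESIDUAL** — p. 416: *"From (3.108) it follows that the expansion (3.107)
is convergent in all norms in the inequalities (3.42)–(3.47). This implies Theorem 3.3."*  The leaf `B9.Thm310Printed c35 geo bg (fun i =>
W310OfOps (𝔬 i) (rd i) (ConvAll3107 (𝔬 i) (R i) (H i) C δ (K i) B₀ δ₀ Bβ Bε Bεβ))` — whose pinned `Converges U` IS Theorem 3.3's typed block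
`B9.Ineq342_346_347 (K i) B₀ δ₀ U ∧ B9.Ineq343_345 (K i) Bβ Bε Bεβ δ₀ U` for the kernel family read from the sum — from the leaf at the
sup-block pin (`B9Thm310Whole.thm310Printed_of_local3107`'s output `h310`) and, per member and per regular configuration, ONLY
operator-level hypothesis schemas of printed shape about the LOCAL operators G_□(U) (Corollary 3.6 in the printed norms: `HolderLegs310`,
`LapLegs310`, `InputLegs310`, `L2TwoLegs310`), the ELEMENTARY FACTORS R_α(X) (bounds of type (3.89): `Factors389`, `FactorsHolder310`,
`FactorsInput310`, `FactorsL2_310`), the STRUCTURE (3.105) (`Identities310`), the static data, the READINGS of `K i` by the model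
operators (`CoRealizes`, `GlobReads`, `L2Reads`, `H1Reads`, `InputReads`), the LETTERS (probes, input block norms, transposes), the member
facts of [4] Lemma 2.1 and the family's constants — the sibling `B9RWSums344Input.thm310Printed_allPin_inputHolder` with its last
displayed line SUPPLIED by `l2line4_of_local310`.  Nothing of print asserted; every input is a hypothesis; NOT a node discharge.
[cite: Balaban1985BackgroundPropagators, Thm 3.10 (3.105)–(3.108) pp.414–416 + Thm 3.3 p.399 + (3.42)–(3.47) pp.397–398 + Cor. 3.6 p.408 + p.413; Balaban1984PropagatorsII, Lemma 2.1 (2.60)–(2.61) p.234] -/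
theorem thm310Printed_allPin_complete {X Y ι A PX PY : I → Type} [∀ i, Fintype (X i)] [∀ i, DecidableEq (X i)]
    [∀ i, Fintype (Y i)] [∀ i, DecidableEq (Y i)] [∀ i, Fintype (ι i)] [∀ i, Fintype (A i)] [∀ i, Fintype (PX i)]
    [∀ i, DecidableEq (PX i)] [∀ i, Fintype (PY i)] [∀ i, DecidableEq (PY i)]
    {𝔬 : ∀ i, Ops310 (geo i) (bg i) (X i) (Y i) (ι i) (A i)}
    {rd : ∀ i, WalkReading310 (geo i) (bg i) (X i) (ι i) (A i)} {R : I → ℝ} {H : I → Prop} {C δ : ℝ}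
    (𝔭 : ∀ i, HolderProbes (geo i) (bg i) (X i) (Y i) (PX i) (PY i))
    (bH : ∀ i, ℝ → BlockNorm (toB6 (geo i) (R i) (H i)) (Y i → ℝ))
    (K : ∀ i, B9.KernelFamily (geo i) (bg i)) (ev : ∀ i, (geo i).Loc → X i → ℝ) (evY : ∀ i, (geo i).Loc → Y i → ℝ)
    {d : ℕ} {α L₀ B₀ δ₀ Mg : ℝ} {Bβ Bε : ℝ → ℝ} {Bεβ : ℝ → ℝ → ℝ}
    (κ : I → Sizes310) (SH : ∀ i, ι i → Finset (geo i).Site) (Bl θH : ℝ → ℝ) (d₁ : ℕ)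
    (δ₁ α₁ ρ N N' NF Cℓ θ₀ NH a₁ M₁ ML : ℝ)
    (SL : ∀ i, ι i → Finset (geo i).Site) (NL BL MF : ℝ) (d₁' : ℕ)
    (SI : ∀ i, ι i → Finset (geo i).Site) (NI : ℝ) (BI θI : ℝ → ℝ) (BI2 : ℝ → ℝ → ℝ)
    (S2 : ∀ i, ι i → Finset (geo i).Site) (N2 B2 θ2 : ℝ)
    (h310 : B9.Thm310Printed c35 geo bg (fun i => W310OfOps (𝔬 i) (rd i) (Conv3107 (𝔬 i) (R i) (H i) C δ)))
    (hco0 : ∀ i U, CoRealizes (K i) 0 U (𝔬 i).blk (𝔬 i).blk (ev i) ((𝔬 i).G U))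
    (hco1 : ∀ i U, CoRealizes (K i) 1 U (𝔬 i).blkY (𝔬 i).blk (ev i) ((𝔬 i).D U ∘ₗ (𝔬 i).G U))
    (hco2 : ∀ i U, CoRealizes (K i) 2 U (𝔬 i).blk (𝔬 i).blkY (evY i) ((𝔬 i).G U ∘ₗ (𝔬 i).Dstar U))
    (hco3 : ∀ i U, CoRealizes (K i) 3 U (𝔬 i).blk (𝔬 i).blk (ev i) ((𝔬 i).Lap U ∘ₗ (𝔬 i).G U))
    (hgl0 : ∀ i U, GlobReads (K i) 0 U (𝔬 i).blk (𝔬 i).blk (ev i) ((𝔬 i).G U))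
    (hgl1 : ∀ i U, GlobReads (K i) 1 U (𝔬 i).blkY (𝔬 i).blk (ev i) ((𝔬 i).D U ∘ₗ (𝔬 i).G U))
    (hgl2 : ∀ i U, GlobReads (K i) 2 U (𝔬 i).blk (𝔬 i).blkY (evY i) ((𝔬 i).G U ∘ₗ (𝔬 i).Dstar U))
    (hgl3 : ∀ i U, GlobReads (K i) 3 U (𝔬 i).blk (𝔬 i).blk (ev i) ((𝔬 i).Lap U ∘ₗ (𝔬 i).G U))
    (hl0 : ∀ i U, L2Reads (R := R i) (H := H i) (K i) 0 U (𝔬 i).blk (𝔬 i).blk (ev i) ((𝔬 i).G U))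
    (hl1 : ∀ i U, L2Reads (R := R i) (H := H i) (K i) 1 U (𝔬 i).blkY (𝔬 i).blk (ev i) ((𝔬 i).D U ∘ₗ (𝔬 i).G U))
    (hl2 : ∀ i U, L2Reads (R := R i) (H := H i) (K i) 2 U (𝔬 i).blk (𝔬 i).blkY (evY i) ((𝔬 i).G U ∘ₗ (𝔬 i).Dstar U))
    (hl3 : ∀ i U, L2Reads (R := R i) (H := H i) (K i) 3 U (𝔬 i).blk (𝔬 i).blk (ev i) ((𝔬 i).Lap U ∘ₗ (𝔬 i).G U))
    (hl4 : ∀ i U, L2Reads (R := R i) (H := H i) (K i) 4 U (𝔬 i).blkY (𝔬 i).blkY (evY i)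
      ((𝔬 i).D U ∘ₗ ((𝔬 i).G U ∘ₗ (𝔬 i).Dstar U)))
    (hl5 : ∀ i U, L2Reads (R := R i) (H := H i) (K i) 5 U (𝔬 i).blk (𝔬 i).blk (ev i) ((𝔬 i).G U ∘ₗ (𝔬 i).Lap U))
    (hH1 : ∀ i U, H1Reads (K i) U (𝔭 i) (𝔬 i).blk (𝔬 i).blkY (ev i) (evY i) ((𝔬 i).D U ∘ₗ (𝔬 i).G U)
      ((𝔬 i).G U ∘ₗ (𝔬 i).Dstar U))
    (hIR : ∀ i U, InputReads (K i) U (𝔭 i) (bH i) (𝔬 i).blkY (evY i) ((𝔬 i).D U ∘ₗ ((𝔬 i).G U ∘ₗ (𝔬 i).Dstar U)))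
    (hsym : ∀ i U, IsTransposePair ((𝔬 i).G U) ((𝔬 i).G U))
    (htr : ∀ i U, IsTransposePair ((𝔬 i).D U ∘ₗ (𝔬 i).G U) ((𝔬 i).G U ∘ₗ (𝔬 i).Dstar U))
    (hadjL : ∀ i U, IsTransposePair ((𝔬 i).Lap U ∘ₗ (𝔬 i).G U) ((𝔬 i).G U ∘ₗ (𝔬 i).Lap U))
    (hfacts : ∀ i, Mg ≤ (geo i).M → Facts347 (geo i) (R i) (H i) d δ α L₀)
    (hdsymm : ∀ i (a b : (geo i).Site), (geo i).dist a b = (geo i).dist b a)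
    (hC : 0 ≤ C) (hCB : C ≤ B₀) (hCL : C * L₀ ≤ B₀) (hδ₀ : δ₀ ≤ (1 - α) * δ) (hδ₀2 : δ₀ ≤ (1 - 2 * α) * δ) (hα : 0 ≤ α * δ)
    (hα2 : 2 * α * δ ≤ δ) (hCg : C * B6.c1 d δ (1 - α) * L₀ ^ (4 : ℝ) ≤ B₀)
    (hc : 0 < c35) (ha₁ : 0 < a₁) (hα₁ : 0 ≤ α₁) (hα₁2 : α₁ ≤ 1 / 2) (hNF : 0 ≤ NF) (hθ₀ : 0 ≤ θ₀) (hNH : 0 ≤ NH)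
    (hδnn : 0 ≤ δ) (hδ5 : δ ≤ (1 - 2 * α₁) * δ₁) (hδ₁ : 0 ≤ δ₁) (hNL : 0 ≤ NL) (hBL : 0 ≤ BL) (hNI : 0 ≤ NI) (hN2 : 0 ≤ N2)
    (hB2 : 0 ≤ B2) (hθ2 : 0 ≤ θ2)
    (hB5 : Real.sqrt (C * lapConst d₁ δ₁ α₁ NL BL L₀) * L₀ ≤ B₀) (hB4 : twoConst d₁ δ₁ α₁ N2 B2 NF θ2 C L₀ ≤ B₀)
    (hst : ∀ i, StaticOK310 (𝔬 i) ρ N N' NF Cℓ (κ i))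
    (hcntH : ∀ i (a : (geo i).Site), (∑ q, if a ∈ SH i q then (1 : ℝ) else 0) ≤ NH)
    (hcntL : ∀ i (a : (geo i).Site), (∑ q, if a ∈ SL i q then (1 : ℝ) else 0) ≤ NL)
    (hcntI : ∀ i (a : (geo i).Site), (∑ q, if a ∈ SI i q then (1 : ℝ) else 0) ≤ NI)
    (hcnt2 : ∀ i (a : (geo i).Site), (∑ q, if a ∈ S2 i q then (1 : ℝ) else 0) ≤ N2)
    (hBl : ∀ β, 0 ≤ β → β < 1 → 0 ≤ Bl β) (hθH : ∀ β, 0 ≤ β → β < 1 → 0 ≤ θH β)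
    (hBI : ∀ ε, 0 < ε → ε ≤ 1 → 0 ≤ BI ε) (hBI2 : ∀ ε β, 0 < ε → ε ≤ 1 → 0 ≤ β → β < 1 → 0 ≤ BI2 ε β)
    (hθI : ∀ ε, 0 < ε → 0 ≤ θI ε)
    (hBβ : ∀ β, 0 ≤ β → β < 1 → holderConst d₁ δ₁ α₁ NH NF C (Bl β) (θH β) ≤ Bβ β)
    (hBε : ∀ ε, 0 < ε → ε ≤ 1 → inputConst44 d₁ δ₁ α₁ NI NF C L₀ (BI ε) (θI ε) ≤ Bε ε)
    (hBεβ : ∀ ε β, 0 < ε → ε ≤ 1 → 0 ≤ β → β < 1 →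
      inputConst45 d₁ δ₁ α₁ NI NF L₀ (holderConst d₁ δ₁ α₁ NH NF C (Bl β) (θH β)) (BI2 ε β) (θI (β + ε)) ≤ Bεβ ε β)
    (h261 : ∀ i, ML ≤ (geo i).M → Ineq261 d₁ (toB6 (geo i) (R i) (H i)) δ₁ α₁)
    (hF₁ : ∀ i, MF ≤ (geo i).M → Facts347 (geo i) (R i) (H i) d₁' δ₁ α₁ L₀)
    (hop : ∀ i, M₁ ≤ (geo i).M → ∀ α₀ : ℝ, 0 < α₀ → c35 * (geo i).M * α₀ ≤ a₁ →
      ∀ U : (bg i).Cfg, (bg i).Reg335 c35 α₀ U →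
        Factors389 (𝔬 i) (R i) (H i) θ₀ δ₁ U ∧ Identities310 (𝔬 i) (R i) (H i) U ∧
          HolderLegs310 (𝔬 i) (𝔭 i) (R i) (H i) (SH i) Bl δ₁ U ∧ FactorsHolder310 (𝔬 i) (𝔭 i) (R i) (H i) θH δ₁ U)
    (hopL : ∀ i, M₁ ≤ (geo i).M → ∀ α₀ : ℝ, 0 < α₀ → c35 * (geo i).M * α₀ ≤ a₁ →
      ∀ U : (bg i).Cfg, (bg i).Reg335 c35 α₀ U → LapLegs310 (𝔬 i) (R i) (H i) (SL i) BL δ₁ U)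
    (hopI : ∀ i, M₁ ≤ (geo i).M → ∀ α₀ : ℝ, 0 < α₀ → c35 * (geo i).M * α₀ ≤ a₁ →
      ∀ U : (bg i).Cfg, (bg i).Reg335 c35 α₀ U →
        InputLegs310 (𝔬 i) (𝔭 i) (R i) (H i) (bH i) (SI i) BI BI2 δ₁ U ∧ FactorsInput310 (𝔬 i) (R i) (H i) (bH i) θI δ₁ U)
    (hop2 : ∀ i, M₁ ≤ (geo i).M → ∀ α₀ : ℝ, 0 < α₀ → c35 * (geo i).M * α₀ ≤ a₁ →
      ∀ U : (bg i).Cfg, (bg i).Reg335 c35 α₀ U →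
        L2TwoLegs310 (𝔬 i) (R i) (H i) (S2 i) B2 δ₁ U ∧ FactorsL2_310 (𝔬 i) (R i) (H i) θ2 δ₁ U) :
    B9.Thm310Printed c35 geo bg
      (fun i => W310OfOps (𝔬 i) (rd i) (ConvAll3107 (𝔬 i) (R i) (H i) C δ (K i) B₀ δ₀ Bβ Bε Bεβ)) := by
  have hαδ₁ : 0 ≤ α₁ * δ₁ := mul_nonneg hα₁ hδ₁
  have hrate : (1 - 2 * α) * δ ≤ (1 - α₁) * δ₁ := by nlinarith [hα, hδ5, hαδ₁]
  have h310' := h310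
  obtain ⟨M₂, a₀, δc, Cc, cc, hM₂, ha₀, -, -, -, hE⟩ := h310'
  have hB₀ : 0 ≤ B₀ := hC.trans hCB
  refine thm310Printed_allPin_inputHolder (Mr := max (max M₂ 1) (max M₁ (max ML Mg))) (ar := min a₀ (a₁ / c35)) 𝔭 bH K ev evY
    κ SH Bl θH d₁ δ₁ α₁ ρ N N' NF Cℓ θ₀ NH a₁ M₁ ML SL NL BL MF d₁' SI NI BI θI BI2 h310 hco0 hco1 hco2 hco3 hgl0 hgl1 hgl2 hgl3
    hl0 hl1 hl2 hl3 hl5 hH1 hIR hsym htr hadjL hfacts hdsymm hC hCB hCL hδ₀ hα (by linarith) hCg (lt_min ha₀ (div_pos ha₁ hc)) hc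
    ha₁ hα₁ hα₁2 hNF hθ₀ hNH hδnn hδ5 hδ₁ hNL hBL hNI hB5 hst hcntH hcntL hcntI hBl hθH hBI hBI2 hθI hBβ hBε hBεβ h261 hF₁ hop
    hopL hopI fun i hM α₀ hα₀ hMa U hU lam h y y' hcut hsupp => ?_
  have hM₂i : M₂ ≤ (geo i).M := le_trans (le_trans (le_max_left _ _) (le_max_left _ _)) hM
  have hM1 : 1 ≤ (geo i).M := le_trans (le_trans (le_max_right _ _) (le_max_left _ _)) hM
  have hM₁i : M₁ ≤ (geo i).M := le_trans (le_trans (le_max_left _ _) (le_max_right _ _)) hM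
  have hMLi : ML ≤ (geo i).M := le_trans (le_trans (le_trans (le_max_left _ _) (le_max_right _ _)) (le_max_right _ _)) hM
  have hMg : Mg ≤ (geo i).M := le_trans (le_trans (le_trans (le_max_right _ _) (le_max_right _ _)) (le_max_right _ _)) hM
  have hMa₀ : (geo i).M * α₀ ≤ a₀ := hMa.trans (min_le_left _ _)
  have ha : c35 * (geo i).M * α₀ ≤ a₁ := by
    have h1 : (geo i).M * α₀ * c35 ≤ a₁ := (le_div_iff₀ hc).mp (hMa.trans (min_le_right _ _))
    calc c35 * (geo i).M * α₀ = (geo i).M * α₀ * c35 := by ring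
      _ ≤ a₁ := h1
  have hconv : Conv3107 (𝔬 i) (R i) (H i) C δ U := (hE i hM₂i α₀ hα₀ hMa₀ U hU).1
  obtain ⟨-, h1, h2, -⟩ := hconv
  obtain ⟨-, hi, -, -⟩ := hop i hM₁i α₀ hα₀ ha U hU
  obtain ⟨hL2, hFL⟩ := hop2 i hM₁i α₀ hα₀ ha U hU
  have hlen0 : ∀ z : (geo i).Site, 0 ≤ (geo i).len z := fun z => ((hst i).lenpos z).le
  have hblk := l2line4_of_local310 (𝔬 i) (R i) (H i) d d₁ δ α L₀ δ₁ α₁ ρ N N' NF Cℓ N2 B2 θ2 C (κ i) (S2 i) U hNF hN2 hB2 hθ2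
    hM1 hC hα2 hαδ₁ hrate (hst i) (hcnt2 i) (h261 i hMLi) (hfacts i hMg) hi hL2 hFL h1 h2 (htr i U)
  have hblk' : BlockBd (g := toB6 (geo i) (R i) (H i)) (𝔬 i).blkY (𝔬 i).blkY ((𝔬 i).D U ∘ₗ ((𝔬 i).G U ∘ₗ (𝔬 i).Dstar U))
      (fun (a b : (geo i).Site) => B₀ * B9.pref6 ((geo i).len a) 4 * Real.exp (-(δ₀ * (geo i).dist a b))) := by
    refine hblk.mono fun a b => ?_
    rw [pref6_four, mul_one]
    exact mul_le_mul hB4 (Real.exp_le_exp.mpr (neg_le_neg (mul_le_mul_of_nonneg_right hδ₀2 ((hst i).dnn a b))))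
      (Real.exp_nonneg _) hB₀
  exact l2line_of_blockBd (hl4 i U) hB₀ hlen0 hblk' lam h y y' hcut hsupp

end AllPinsG

end

end Literature.MathematicalPhysics.QuantumFieldTheory.Balaban1983to89.B9RWSums346Two
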